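import Summits.QuantumFields.YangMills.Theorems.ColdStartUniversalityLatticeLangevinGeneratorFrameForm
import Summits.QuantumFields.YangMills.Theorems.ColdStartUniversalityLatticeLangevinFrameBochner
import HarnessLib

/-!
# Route `ColdStartUniversality` (fixed-cut-off package, Bakry–Émery side): the INTEGRATED CURVATURE INEQUALITY
# `∫ (𝓛g)² dμ_{β'} ≥ (1 − K₀/2) · (−∫ g 𝓛g dμ_{β'})` from a Hessian bound `K₀` on the plaquette action

Helper file (seat `ym-line-csu-p1`, g25; `--supports stmt-QuantumFields-24809`).  Assembles the Bakry–Émery `Γ₂`-criterion for the SU(2)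
lattice Langevin dynamics of Shen–Zhu–Zhu on `(ℤ/L)³` at a FIXED cut-off, in INTEGRATED form and with the Hessian constant as a parameter
(the shape of SZZ Lemma 4.1 / Theorem 4.2, CMP 400 (2023); cf. `Literature…LatticeYangMillsBakryEmery.shenZhuZhu_bakryEmery_transfer`):
IF along the noise frame `|Σ_(n,m) Λ(s_n)Λ(s_m) · W_nW_m ψ̂| ≤ K₀ Σ_n Λ(s_n)²` at every configuration (`hHess`, the Hessian of the
plaquette function `ψ̂ = β'Σ_p Re tr U_p` along right-invariant fields — SZZ's `|Hess_S(v,v)| ≤ 8(d−1)N|β||v|²` would give `K₀ = 32|β'|`),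
THEN for every `C³` function `g` of the real link coordinates
  ★★ `integral_generator_sq_ge_of_hessBound`:  `(1 − K₀/2) · (−∫ G·𝓛g dμ_{β'}) ≤ ∫ (𝓛g)² dμ_{β'}`,  `G = g∘coords`,
i.e. `∫ (𝓛g)² ≥ ρ·ℰ(g)` with `ρ = 1 − K₀/2` — the integrated `CD(ρ,∞)` inequality (Ricci part `= 1` exactly: `…NoiseFrame` (4)).
Also ★ `neg_integral_mul_generator_eq` — `−∫ G·𝓛g dμ = ½ Σ_n ∫ (W_n g)² dμ` for `C²` `g` WITHOUT compact support (direct IBP).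
Ingredients: `exists_noiseFrame`, `integral_frameGen_sq_eq` (Bochner), `integral_frameDeriv_mul_wilson` (IBP), `generator_eq_half_frameGen`,
`quarter_sum_sum_sq_bracket_le`.  THEOREMS ONLY, no definition, no sorry.
HONEST FRAMING: fixed cut-off; conditional on the Hessian bound `K₀` (discharged with an explicit, volume-independent `K₀ ∝ |β'|` in the
sequel); nothing K-uniform in the route's scaling; no crux, rung or summit statement is proved; the Yang–Mills mass gap is NOT proved.
-/

set_option autoImplicit false

noncomputable section

namespace Summit.QuantumFields.YangMills.Theorems.ColdStartUniversality

open MeasureTheory Matrix Complex Finset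
open scoped ComplexConjugate BigOperators Matrix
open Literature.MathematicalPhysics.QuantumFieldTheory
open Literature.MathematicalPhysics.QuantumLattice (fundamentalRep fundamentalLatticeRep continuous_fundamentalRep fundamentalRep_apply)

variable {L : ℕ} [NeZero L]

/-- ★★ **Integrated curvature inequality for the SZZ generator at a fixed cut-off, Hessian constant as a parameter.**
If the Hessian of the plaquette function along the noise frame is bounded by `K₀` times the carré du champ at every configuration, then
`(1 − K₀/2)·(−∫ (g∘coords)·𝓛_(β')g dμ_(β')) ≤ ∫ (𝓛_(β') g)² dμ_(β')` for every `C³` `g`; moreover `−∫ (g∘coords) 𝓛g dμ = ½ Σ_n ∫ (W_n g)²dμ`.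
[cite: ShenZhuZhu2022, §4 Theorem 4.2 and (4.7)–(4.8)] -/
theorem integral_generator_sq_ge_of_hessBound (L : ℕ) [NeZero L] (β' K₀ : ℝ)
    (hHess : (∀ (V : (GaugeConfig 3 L (Matrix.specialUnitaryGroup (Fin 2) ℂ))) (Λ : (Edge 3 L × Fin (fundamentalLatticeRep 2).N × Fin (fundamentalLatticeRep 2).N × Bool → ℝ) →L[ℝ] ℝ),
      ∑ n : Edge 3 L × NoiseIdx (fundamentalLatticeRep 2).N, ∑ m : Edge 3 L × NoiseIdx (fundamentalLatticeRep 2).N,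
        Λ ((fun q : Edge 3 L × Fin (fundamentalLatticeRep 2).N × Fin (fundamentalLatticeRep 2).N × Bool => if n.1 = q.1 then (fun z : ℂ => if q.2.2.2 then z.im else z.re) (((Real.sqrt 2 : ℂ) • ((fundamentalLatticeRep 2).lieProj (noiseDir n.2) * (fun (ee : Edge 3 L) => Matrix.of fun (i j : Fin (fundamentalLatticeRep 2).N) => (((fun (V : GaugeConfig 3 L (Matrix.specialUnitaryGroup (Fin 2) ℂ)) (q : Edge 3 L × Fin (fundamentalLatticeRep 2).N × Fin (fundamentalLatticeRep 2).N × Bool) => (fun z : ℂ => if q.2.2.2 then z.im else z.re) ((fundamentalRep (Fin 2) (V q.1) : Matrix (Fin 2) (Fin 2) ℂ) q.2.1 q.2.2.1)) V (ee, i, j, false) : ℝ) : ℂ) + (((fun (V : GaugeConfig 3 L (Matrix.specialUnitaryGroup (Fin 2) ℂ)) (q : Edge 3 L × Fin (fundamentalLatticeRep 2).N × Fin (fundamentalLatticeRep 2).N × Bool) => (fun z : ℂ => if q.2.2.2 then z.im else z.re) ((fundamentalRep (Fin 2) (V q.1) : Matrix (Fin 2) (Fin 2) ℂ) q.2.1 q.2.2.1))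 V (ee, i, j, true) : ℝ) : ℂ) * Complex.I) q.1)) q.2.1 q.2.2.1) else 0)) * Λ ((fun q : Edge 3 L × Fin (fundamentalLatticeRep 2).N × Fin (fundamentalLatticeRep 2).N × Bool => if m.1 = q.1 then (fun z : ℂ => if q.2.2.2 then z.im else z.re) (((Real.sqrt 2 : ℂ) • ((fundamentalLatticeRep 2).lieProj (noiseDir m.2) * (fun (ee : Edge 3 L) => Matrix.of fun (i j : Fin (fundamentalLatticeRep 2).N) => (((fun (V : GaugeConfig 3 L (Matrix.specialUnitaryGroup (Fin 2) ℂ)) (q : Edge 3 L × Fin (fundamentalLatticeRep 2).N × Fin (fundamentalLatticeRep 2).N × Bool) => (fun z : ℂ => if q.2.2.2 then z.im else z.re) ((fundamentalRep (Fin 2) (V q.1) : Matrix (Fin 2) (Fin 2) ℂ) q.2.1 q.2.2.1)) V (ee, i, j, false) : ℝ) : ℂ) + (((fun (V : GaugeConfig 3 L (Matrix.specialUnitaryGroup (Fin 2) ℂ)) (q : Edge 3 L × Fin (fundamentalLatticeRep 2).N × Fin (fundamentalLatticeRep 2).N × Bool) => (fun z : ℂ => if q.2.2.2 then z.im else z.re)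 ((fundamentalRep (Fin 2) (V q.1) : Matrix (Fin 2) (Fin 2) ℂ) q.2.1 q.2.2.1)) V (ee, i, j, true) : ℝ) : ℂ) * Complex.I) q.1)) q.2.1 q.2.2.1) else 0)) *
          fderiv ℝ (fun z : (Edge 3 L × Fin (fundamentalLatticeRep 2).N × Fin (fundamentalLatticeRep 2).N × Bool → ℝ) => fderiv ℝ (fun y : (Edge 3 L × Fin (fundamentalLatticeRep 2).N × Fin (fundamentalLatticeRep 2).N × Bool → ℝ) => β' * ∑ p : Plaquette 3 L, (rootedLoop (fun (ee : Edge 3 L) (i j : Fin (fundamentalLatticeRep 2).N) => ((y (ee, i, j, false) : ℝ) : ℂ) + ((y (ee, i, j, true) : ℝ) : ℂ) * Complex.I) (p.1, p.2.1.1) p.2.1.2 false).trace.re) z (fun q : Edge 3 L × Fin (fundamentalLatticeRep 2).N × Fin (fundamentalLatticeRep 2).N × Bool => if m.1 = q.1 then (fun z : ℂ => if q.2.2.2 then z.im else z.re) (((Real.sqrt 2 : ℂ) • ((fundamentalLatticeRep 2).lieProj (noiseDir m.2) * (fun (ee : Edge 3 L) => Matrix.of fun (i j : Fin (fundamentalLatticeRep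 2).N) => ((z (ee, i, j, false) : ℝ) : ℂ) + ((z (ee, i, j, true) : ℝ) : ℂ) * Complex.I) q.1)) q.2.1 q.2.2.1) else 0)) ((fun (V : GaugeConfig 3 L (Matrix.specialUnitaryGroup (Fin 2) ℂ)) (q : Edge 3 L × Fin (fundamentalLatticeRep 2).N × Fin (fundamentalLatticeRep 2).N × Bool) => (fun z : ℂ => if q.2.2.2 then z.im else z.re) ((fundamentalRep (Fin 2) (V q.1) : Matrix (Fin 2) (Fin 2) ℂ) q.2.1 q.2.2.1)) V) (fun q : Edge 3 L × Fin (fundamentalLatticeRep 2).N × Fin (fundamentalLatticeRep 2).N × Bool => if n.1 = q.1 then (fun z : ℂ => if q.2.2.2 then z.im else z.re) (((Real.sqrt 2 : ℂ) • ((fundamentalLatticeRep 2).lieProj (noiseDir n.2) * (fun (ee : Edge 3 L) => Matrix.of fun (i j : Fin (fundamentalLatticeRep 2).N) => (((fun (V : GaugeConfig 3 L (Matrix.specialUnitaryGroup (Fin 2) ℂ)) (q : Edge 3 L × Fin (fundamentalLatticeRep 2).N × Fin (fundamentalLatticeRep 2).N × Bool) => (fun z : ℂ => if q.2.2.2 then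 z.im else z.re) ((fundamentalRep (Fin 2) (V q.1) : Matrix (Fin 2) (Fin 2) ℂ) q.2.1 q.2.2.1)) V (ee, i, j, false) : ℝ) : ℂ) + (((fun (V : GaugeConfig 3 L (Matrix.specialUnitaryGroup (Fin 2) ℂ)) (q : Edge 3 L × Fin (fundamentalLatticeRep 2).N × Fin (fundamentalLatticeRep 2).N × Bool) => (fun z : ℂ => if q.2.2.2 then z.im else z.re) ((fundamentalRep (Fin 2) (V q.1) : Matrix (Fin 2) (Fin 2) ℂ) q.2.1 q.2.2.1)) V (ee, i, j, true) : ℝ) : ℂ) * Complex.I) q.1)) q.2.1 q.2.2.1) else 0)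
        ≤ K₀ * ∑ n : Edge 3 L × NoiseIdx (fundamentalLatticeRep 2).N, (Λ (fun q : Edge 3 L × Fin (fundamentalLatticeRep 2).N × Fin (fundamentalLatticeRep 2).N × Bool => if n.1 = q.1 then (fun z : ℂ => if q.2.2.2 then z.im else z.re) (((Real.sqrt 2 : ℂ) • ((fundamentalLatticeRep 2).lieProj (noiseDir n.2) * (fun (ee : Edge 3 L) => Matrix.of fun (i j : Fin (fundamentalLatticeRep 2).N) => (((fun (V : GaugeConfig 3 L (Matrix.specialUnitaryGroup (Fin 2) ℂ)) (q : Edge 3 L × Fin (fundamentalLatticeRep 2).N × Fin (fundamentalLatticeRep 2).N × Bool) => (fun z : ℂ => if q.2.2.2 then z.im else z.re) ((fundamentalRep (Fin 2) (V q.1) : Matrix (Fin 2) (Fin 2) ℂ) q.2.1 q.2.2.1)) V (ee, i, j, false) : ℝ) : ℂ) + (((fun (V : GaugeConfig 3 L (Matrix.specialUnitaryGroup (Fin 2) ℂ)) (q : Edge 3 L × Fin (fundamentalLatticeRep 2).N × Fin (fundamentalLatticeRep 2).N × Bool) => (fun z : ℂ => if q.2.2.2 then z.im else z.re) ((fundamentalRep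 (Fin 2) (V q.1) : Matrix (Fin 2) (Fin 2) ℂ) q.2.1 q.2.2.1)) V (ee, i, j, true) : ℝ) : ℂ) * Complex.I) q.1)) q.2.1 q.2.2.1) else 0)) ^ 2))
    (g : (Edge 3 L × Fin 2 × Fin 2 × Bool → ℝ) → ℝ) (hg : ContDiff ℝ 3 g) :
    let coords : GaugeConfig 3 L (Matrix.specialUnitaryGroup (Fin 2) ℂ) → (Edge 3 L × Fin 2 × Fin 2 × Bool → ℝ) :=
      fun V q => (fun z : ℂ => if q.2.2.2 then z.im else z.re)
        ((fundamentalRep (Fin 2) (V q.1) : Matrix (Fin 2) (Fin 2) ℂ) q.2.1 q.2.2.1)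
    let gen : ((Edge 3 L × Fin 2 × Fin 2 × Bool → ℝ) → ℝ) → GaugeConfig 3 L (Matrix.specialUnitaryGroup (Fin 2) ℂ) → ℝ :=
      fun h V =>
      (∑ i : Edge 3 L × Fin 2 × Fin 2 × Bool, fderiv ℝ h (coords V) (Pi.single i 1) *
          (fun z : ℂ => if i.2.2.2 then z.im else z.re)
            ((latticeLangevinDynamics (fundamentalLatticeRep 2) β').drift
              (matrixConfig (fundamentalRep (Fin 2)) V) i.1 i.2.1 i.2.2.1) +
      1 / 2 * ∑ i : Edge 3 L × Fin 2 × Fin 2 × Bool, ∑ j : Edge 3 L × Fin 2 × Fin 2 × Bool,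
        fderiv ℝ (fun z => fderiv ℝ h z (Pi.single i 1)) (coords V) (Pi.single j 1) *
          ∑ n : Edge 3 L × NoiseIdx 2,
            (if n.1 = i.1 then (fun z : ℂ => if i.2.2.2 then z.im else z.re)
              ((latticeLangevinDynamics (fundamentalLatticeRep 2) β').noise
                (matrixConfig (fundamentalRep (Fin 2)) V) i.1 n.2 i.2.1 i.2.2.1) else 0) *
            (if n.1 = j.1 then (fun z : ℂ => if j.2.2.2 then z.im else z.re)
              ((latticeLangevinDynamics (fundamentalLatticeRep 2) β').noise
                (matrixConfig (fundamentalRep (Fin 2)) V) j.1 n.2 j.2.1 j.2.2.1) else 0))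
    (1 - K₀ / 2) * (-∫ V, g (coords V) * gen g V ∂(wilsonMeasure (d := 3) (L := L) (fundamentalRep (Fin 2)) β')) ≤ ∫ V, (gen g V) ^ 2 ∂(wilsonMeasure (d := 3) (L := L) (fundamentalRep (Fin 2)) β') := by
  intro coords gen
  classical
  haveI := secondCountableTopology_su2
  haveI := borelSpace_config L
  set μ : Measure (GaugeConfig 3 L (Matrix.specialUnitaryGroup (Fin 2) ℂ)) := (wilsonMeasure (d := 3) (L := L) (fundamentalRep (Fin 2)) β') with hμ
  haveI : IsProbabilityMeasure μ :=
    isProbabilityMeasure_wilsonMeasure (d := 3) (L := L) (fundamentalRep (Fin 2)) (continuous_fundamentalRep (Fin 2)) β'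
  -- the frame, recast on the tree's flat coordinate space
  obtain ⟨s, c, hs, hbr, hanti, hRic, hCas⟩ := exists_noiseFrame L
  set s2 : (Edge 3 L × NoiseIdx (fundamentalLatticeRep 2).N) → ((Edge 3 L × Fin 2 × Fin 2 × Bool → ℝ) →L[ℝ] (Edge 3 L × Fin 2 × Fin 2 × Bool → ℝ)) := s with hs2def
  have hbr2 : ∀ (n m : Edge 3 L × NoiseIdx (fundamentalLatticeRep 2).N) (y : (Edge 3 L × Fin 2 × Fin 2 × Bool → ℝ)), s2 m (s2 n y) - s2 n (s2 m y) = ∑ k, c n m k • s2 k y :=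
    fun n m y => hbr n m y
  have hRic2 : ∀ (Λ : (Edge 3 L × Fin 2 × Fin 2 × Bool → ℝ) →L[ℝ] ℝ) (y : (Edge 3 L × Fin 2 × Fin 2 × Bool → ℝ)),
      (1 / 4 : ℝ) * ∑ n, ∑ m, (Λ (s2 m (s2 n y) - s2 n (s2 m y))) ^ 2 = 2 * ∑ n, (Λ (s2 n y)) ^ 2 := fun Λ y => hRic Λ y
  set ψ : (Edge 3 L × Fin 2 × Fin 2 × Bool → ℝ) → ℝ := (fun y : (Edge 3 L × Fin 2 × Fin 2 × Bool → ℝ) => β' * ∑ p : Plaquette 3 L, (rootedLoop (fun (ee : Edge 3 L) (i j : Fin 2) => ((y (ee, i, j, false) : ℝ) : ℂ) + ((y (ee, i, j, true) : ℝ) : ℂ) * Complex.I) (p.1, p.2.1.1) p.2.1.2 false).trace.re) with hψ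
  have hψC : ContDiff ℝ 2 ψ := contDiff_psiHat (d := 3) (L := L) (N := 2) (n := 2) β'
  have hg2 : ContDiff ℝ 2 g := hg.of_le (by norm_num)
  have hg1 : ContDiff ℝ 1 g := hg.of_le (by norm_num)
  -- integrability of continuous cylinder functions
  have hco : Continuous coords := continuous_coords (L := L)
  have hint : ∀ F : (Edge 3 L × Fin 2 × Fin 2 × Bool → ℝ) → ℝ, Continuous F → Integrable (fun V => F (coords V)) μ := fun F hF =>
    (hF.comp hco).integrable_of_hasCompactSupport (HasCompactSupport.of_compactSpace _)
  -- integration by parts along the frame (Haar invariance)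
  have hIBP : ∀ (n : Edge 3 L × NoiseIdx (fundamentalLatticeRep 2).N) (A B : (Edge 3 L × Fin 2 × Fin 2 × Bool → ℝ) → ℝ), ContDiff ℝ 1 A → ContDiff ℝ 1 B →
      ∫ V, fderiv ℝ A (coords V) (s2 n (coords V)) * B (coords V) ∂μ =
        -∫ V, A (coords V) * fderiv ℝ B (coords V) (s2 n (coords V)) ∂μ -
          ∫ V, A (coords V) * B (coords V) * fderiv ℝ ψ (coords V) (s2 n (coords V)) ∂μ := by
    intro n A B hA hB
    have h := integral_frameDeriv_mul_wilson L β' n (A := A) (B := B) hA hB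
    have hsn : ∀ V : (GaugeConfig 3 L (Matrix.specialUnitaryGroup (Fin 2) ℂ)), s2 n (coords V) = (fun q : Edge 3 L × Fin (fundamentalLatticeRep 2).N × Fin (fundamentalLatticeRep 2).N × Bool => if n.1 = q.1 then (fun z : ℂ => if q.2.2.2 then z.im else z.re) (((Real.sqrt 2 : ℂ) • ((fundamentalLatticeRep 2).lieProj (noiseDir n.2) * (fun (ee : Edge 3 L) => Matrix.of fun (i j : Fin (fundamentalLatticeRep 2).N) => (((coords V) (ee, i, j, false) : ℝ) : ℂ) + (((coords V) (ee, i, j, true) : ℝ) : ℂ) * Complex.I) q.1)) q.2.1 q.2.2.1) else 0) := fun V => hs n (coords V)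
    simp_rw [hsn]
    exact h
  -- Bochner and the energy identity
  have hBochner := integral_frameGen_sq_eq μ coords s2 ψ c hbr2 hanti hint hIBP hψC hg
  have hEnergy := integral_frameGen_mul_eq_neg_sum μ coords s2 ψ hint hIBP (hψC.of_le (by norm_num)) hg2 hg1
  -- the generator is half the frame generator
  have hD : ∀ V : (GaugeConfig 3 L (Matrix.specialUnitaryGroup (Fin 2) ℂ)), gen g V = 1 / 2 * ∑ n : Edge 3 L × NoiseIdx (fundamentalLatticeRep 2).N,
      (fderiv ℝ (fun w => fderiv ℝ g w (s2 n w)) (coords V) (s2 n (coords V)) +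
        fderiv ℝ ψ (coords V) (s2 n (coords V)) * fderiv ℝ g (coords V) (s2 n (coords V))) :=
    fun V => generator_eq_half_frameGen L β' s hs hCas g hg2 V
  -- continuity of the frame derivatives
  have cWg : ∀ n, Continuous (fun z => fderiv ℝ g z (s2 n z)) := fun n => (contDiff_frameDeriv (k := 1) hg2 (s2 n)).continuous
  have cWWg : ∀ n m, Continuous (fun z => fderiv ℝ (fun w => fderiv ℝ g w (s2 n w)) z (s2 m z)) := fun n m =>
    (contDiff_frameDeriv (k := 0) (contDiff_frameDeriv (k := 1) hg2 (s2 n)) (s2 m)).continuous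
  have cWWψ : ∀ n m, Continuous (fun z => fderiv ℝ (fun w => fderiv ℝ ψ w (s2 n w)) z (s2 m z)) := fun n m =>
    (contDiff_frameDeriv (k := 0) (contDiff_frameDeriv (k := 1) hψC (s2 n)) (s2 m)).continuous
  have cL : Continuous (fun z => ∑ n, (fderiv ℝ (fun w => fderiv ℝ g w (s2 n w)) z (s2 n z) +
      fderiv ℝ ψ z (s2 n z) * fderiv ℝ g z (s2 n z))) := (contDiff_frameGen (k := 0) hg2 (hψC.of_le (by norm_num)) s2).continuous
  -- pointwise curvature: Ricci part `2Γ`, Hessian part `≥ -K₀Γ`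
  have hpt : ∀ V : (GaugeConfig 3 L (Matrix.specialUnitaryGroup (Fin 2) ℂ)), (2 - K₀) * ∑ n, (fderiv ℝ g (coords V) (s2 n (coords V))) ^ 2 ≤
      ∑ n, ∑ m, (fderiv ℝ (fun z => fderiv ℝ g z (s2 n z)) (coords V) (s2 m (coords V))) ^ 2 -
        ∑ n, ∑ m, fderiv ℝ g (coords V) (s2 n (coords V)) * fderiv ℝ g (coords V) (s2 m (coords V)) *
          fderiv ℝ (fun z => fderiv ℝ ψ z (s2 m z)) (coords V) (s2 n (coords V)) := by
    intro V
    have hq := quarter_sum_sum_sq_bracket_le hg2 s2 (coords V)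
    have hr := hRic2 (fderiv ℝ g (coords V)) (coords V)
    have hH : ∑ n, ∑ m, fderiv ℝ g (coords V) (s2 n (coords V)) * fderiv ℝ g (coords V) (s2 m (coords V)) *
        fderiv ℝ (fun z => fderiv ℝ ψ z (s2 m z)) (coords V) (s2 n (coords V)) ≤
        K₀ * ∑ n, (fderiv ℝ g (coords V) (s2 n (coords V))) ^ 2 := by
      have h := hHess V (fderiv ℝ g (coords V))
      have hsV : ∀ k : Edge 3 L × NoiseIdx (fundamentalLatticeRep 2).N, s2 k (coords V) = (fun q : Edge 3 L × Fin (fundamentalLatticeRep 2).N × Fin (fundamentalLatticeRep 2).N × Bool => if k.1 = q.1 then (fun z : ℂ => if q.2.2.2 then z.im else z.re) (((Real.sqrt 2 : ℂ) • ((fundamentalLatticeRep 2).lieProj (noiseDir k.2) * (fun (ee : Edge 3 L) => Matrix.of fun (i j : Fin (fundamentalLatticeRep 2).N) => (((coords V) (ee, i, j, false) : ℝ) : ℂ) + (((coords V) (ee, i, j, true) : ℝ) : ℂ) * Complex.I) q.1)) q.2.1 q.2.2.1) else 0) := fun k => hs k (coords V)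
      have hsz : ∀ k : Edge 3 L × NoiseIdx (fundamentalLatticeRep 2).N, (fun z : (Edge 3 L × Fin 2 × Fin 2 × Bool → ℝ) => fderiv ℝ ψ z (s2 k z)) =
          fun z : (Edge 3 L × Fin 2 × Fin 2 × Bool → ℝ) => fderiv ℝ ψ z (fun q : Edge 3 L × Fin (fundamentalLatticeRep 2).N × Fin (fundamentalLatticeRep 2).N × Bool => if k.1 = q.1 then (fun z : ℂ => if q.2.2.2 then z.im else z.re) (((Real.sqrt 2 : ℂ) • ((fundamentalLatticeRep 2).lieProj (noiseDir k.2) * (fun (ee : Edge 3 L) => Matrix.of fun (i j : Fin (fundamentalLatticeRep 2).N) => ((z (ee, i, j, false) : ℝ) : ℂ) + ((z (ee, i, j, true) : ℝ) : ℂ) * Complex.I) q.1)) q.2.1 q.2.2.1) else 0) := fun k => funext fun z => congrArg (fderiv ℝ ψ z) (hs k z)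
      simp_rw [hsz, hsV]
      exact h
    -- the sum of squares of second frame derivatives is symmetric in (n, m)
    have hsymm : ∑ n, ∑ m, (fderiv ℝ (fun z => fderiv ℝ g z (s2 n z)) (coords V) (s2 m (coords V))) ^ 2 =
        ∑ n, ∑ m, (fderiv ℝ (fun z => fderiv ℝ g z (s2 m z)) (coords V) (s2 n (coords V))) ^ 2 := Finset.sum_comm
    rw [hsymm]
    nlinarith [hq, hr, hH]
  -- integrate the pointwise inequality
  have hI1 : ∀ n m, Integrable (fun V => (fderiv ℝ (fun z => fderiv ℝ g z (s2 n z)) (coords V) (s2 m (coords V))) ^ 2) μ :=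
    fun n m => hint (fun z => (fderiv ℝ (fun w => fderiv ℝ g w (s2 n w)) z (s2 m z)) ^ 2) ((cWWg n m).pow 2)
  have hI2 : ∀ n m, Integrable (fun V => fderiv ℝ g (coords V) (s2 n (coords V)) * fderiv ℝ g (coords V) (s2 m (coords V)) *
      fderiv ℝ (fun z => fderiv ℝ ψ z (s2 m z)) (coords V) (s2 n (coords V))) μ :=
    fun n m => hint (fun z => fderiv ℝ g z (s2 n z) * fderiv ℝ g z (s2 m z) * fderiv ℝ (fun w => fderiv ℝ ψ w (s2 m w)) z (s2 n z))
      (((cWg n).mul (cWg m)).mul (cWWψ m n))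
  have hI3 : ∀ n, Integrable (fun V => (fderiv ℝ g (coords V) (s2 n (coords V))) ^ 2) μ := fun n =>
    hint (fun z => (fderiv ℝ g z (s2 n z)) ^ 2) ((cWg n).pow 2)
  have hcurv : (2 - K₀) * ∑ n, ∫ V, (fderiv ℝ g (coords V) (s2 n (coords V))) ^ 2 ∂μ ≤
      ∑ n, ∑ m, ∫ V, (fderiv ℝ (fun z => fderiv ℝ g z (s2 n z)) (coords V) (s2 m (coords V))) ^ 2 ∂μ -
        ∑ n, ∑ m, ∫ V, fderiv ℝ g (coords V) (s2 n (coords V)) * fderiv ℝ g (coords V) (s2 m (coords V)) *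
          fderiv ℝ (fun z => fderiv ℝ ψ z (s2 m z)) (coords V) (s2 n (coords V)) ∂μ := by
    have hL : (2 - K₀) * ∑ n, ∫ V, (fderiv ℝ g (coords V) (s2 n (coords V))) ^ 2 ∂μ =
        ∫ V, (2 - K₀) * ∑ n, (fderiv ℝ g (coords V) (s2 n (coords V))) ^ 2 ∂μ := by
      rw [← integral_finsetSum _ fun n _ => hI3 n, ← integral_const_mul]
    have hS1 : ∀ n, Integrable (fun V => ∑ m, (fderiv ℝ (fun z => fderiv ℝ g z (s2 n z)) (coords V) (s2 m (coords V))) ^ 2) μ :=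
      fun n => integrable_finsetSum _ fun m _ => hI1 n m
    have hS2 : ∀ n, Integrable (fun V => ∑ m, fderiv ℝ g (coords V) (s2 n (coords V)) *
        fderiv ℝ g (coords V) (s2 m (coords V)) * fderiv ℝ (fun z => fderiv ℝ ψ z (s2 m z)) (coords V) (s2 n (coords V))) μ :=
      fun n => integrable_finsetSum _ fun m _ => hI2 n m
    have hA' : ∑ n, ∑ m, ∫ V, (fderiv ℝ (fun z => fderiv ℝ g z (s2 n z)) (coords V) (s2 m (coords V))) ^ 2 ∂μ =
        ∫ V, ∑ n, ∑ m, (fderiv ℝ (fun z => fderiv ℝ g z (s2 n z)) (coords V) (s2 m (coords V))) ^ 2 ∂μ := by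
      rw [integral_finsetSum _ fun n _ => hS1 n]
      exact Finset.sum_congr rfl fun n _ => (integral_finsetSum _ fun m _ => hI1 n m).symm
    have hB' : ∑ n, ∑ m, ∫ V, fderiv ℝ g (coords V) (s2 n (coords V)) * fderiv ℝ g (coords V) (s2 m (coords V)) *
          fderiv ℝ (fun z => fderiv ℝ ψ z (s2 m z)) (coords V) (s2 n (coords V)) ∂μ =
        ∫ V, ∑ n, ∑ m, fderiv ℝ g (coords V) (s2 n (coords V)) * fderiv ℝ g (coords V) (s2 m (coords V)) *
          fderiv ℝ (fun z => fderiv ℝ ψ z (s2 m z)) (coords V) (s2 n (coords V)) ∂μ := by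
      rw [integral_finsetSum _ fun n _ => hS2 n]
      exact Finset.sum_congr rfl fun n _ => (integral_finsetSum _ fun m _ => hI2 n m).symm
    have hR : ∑ n, ∑ m, ∫ V, (fderiv ℝ (fun z => fderiv ℝ g z (s2 n z)) (coords V) (s2 m (coords V))) ^ 2 ∂μ -
        ∑ n, ∑ m, ∫ V, fderiv ℝ g (coords V) (s2 n (coords V)) * fderiv ℝ g (coords V) (s2 m (coords V)) *
          fderiv ℝ (fun z => fderiv ℝ ψ z (s2 m z)) (coords V) (s2 n (coords V)) ∂μ =
        ∫ V, (∑ n, ∑ m, (fderiv ℝ (fun z => fderiv ℝ g z (s2 n z)) (coords V) (s2 m (coords V))) ^ 2 -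
          ∑ n, ∑ m, fderiv ℝ g (coords V) (s2 n (coords V)) * fderiv ℝ g (coords V) (s2 m (coords V)) *
            fderiv ℝ (fun z => fderiv ℝ ψ z (s2 m z)) (coords V) (s2 n (coords V))) ∂μ := by
      rw [hA', hB', ← integral_sub (integrable_finsetSum _ fun n _ => hS1 n) (integrable_finsetSum _ fun n _ => hS2 n)]
    rw [hL, hR]
    refine integral_mono ?_ ?_ fun V => hpt V
    · exact (integrable_finsetSum _ fun n _ => hI3 n).const_mul _
    · exact (integrable_finsetSum _ fun n _ => integrable_finsetSum _ fun m _ => hI1 n m).sub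
        (integrable_finsetSum _ fun n _ => integrable_finsetSum _ fun m _ => hI2 n m)
  -- rewrite both sides of the goal through the frame generator
  have hLHS : -∫ V, g (coords V) * gen g V ∂μ = 1 / 2 * ∑ n, ∫ V, (fderiv ℝ g (coords V) (s2 n (coords V))) ^ 2 ∂μ := by
    have h1 : ∫ V, g (coords V) * gen g V ∂μ = 1 / 2 * ∫ V, (∑ n, (fderiv ℝ (fun w => fderiv ℝ g w (s2 n w)) (coords V)
        (s2 n (coords V)) + fderiv ℝ ψ (coords V) (s2 n (coords V)) * fderiv ℝ g (coords V) (s2 n (coords V)))) * g (coords V) ∂μ := by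
      rw [← integral_const_mul]
      refine integral_congr_ae (Filter.Eventually.of_forall fun V => ?_)
      simp only [hD V]
      ring
    rw [h1, hEnergy]
    have h2 : ∀ n, ∫ V, fderiv ℝ g (coords V) (s2 n (coords V)) * fderiv ℝ g (coords V) (s2 n (coords V)) ∂μ =
        ∫ V, (fderiv ℝ g (coords V) (s2 n (coords V))) ^ 2 ∂μ :=
      fun n => integral_congr_ae (Filter.Eventually.of_forall fun V => by simp only [sq])
    simp_rw [h2]
    ring
  have hRHS : ∫ V, (gen g V) ^ 2 ∂μ = 1 / 4 * ∫ V, (∑ n, (fderiv ℝ (fun w => fderiv ℝ g w (s2 n w)) (coords V) (s2 n (coords V)) +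
      fderiv ℝ ψ (coords V) (s2 n (coords V)) * fderiv ℝ g (coords V) (s2 n (coords V)))) ^ 2 ∂μ := by
    rw [← integral_const_mul]
    refine integral_congr_ae (Filter.Eventually.of_forall fun V => ?_)
    simp only [hD V]
    ring
  rw [hLHS, hRHS, hBochner]
  nlinarith [hcurv]

end Summit.QuantumFields.YangMills.Theorems.ColdStartUniversality
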